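import Mathlib
import HarnessLib
import Summits.FinalStateConjecture.FinalStateConjecture.Theses.SwallowTheDatum
import Literature.Geometry.Lorentzian.ModelData

/-!
# Sketch — crux idea `bag-of-gold-throat-recession` for `SwallowTheDatum.KerrShieldedDataExist`
(planner-cruxidea-stmt-FinalStateConjecture-10055-2-0; First lemma + transfer statement; nothing
here is proved, the defs must merely elaborate.)
-/

noncomputable section

open scoped Manifold ContDiff Topology
open Set Literature.Geometry.Lorentzian

namespace Summit.FinalStateConjecture.FinalStateConjecture.Cruxes.KerrShieldedDataExist.BagOfGoldThroatRecession

/-- **C⁺ (transfer target): a time-symmetric vacuum BAG OF GOLD exactly Schwarzschild through the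
throat.** There is an admissible, time-symmetric (`k = 0`) vacuum datum `D` on `E3` and `0 < ρ₁ < M/40`
such that `D` restricted (via a smooth open embedding `φ` with compact complement of its range) to
the isotropic annulus-to-infinity `{ρ₁ < ‖y‖}` IS the conformally flat Schwarzschild slice
`((1 + M/(2‖y‖))⁴ δ, 0)` — a region containing the whole first sheet, the minimal throat `‖y‖ = M/2`
and the second sheet down to isotropic radius `ρ₁` (mirrored areal radius `> 10 M`). -/
def SchwarzschildBagOfGoldExists : Prop :=
  ∃ D ∈ admissibleVacuumData E3, D.IsTimeSymmetric ∧
    ∃ (M ρ₁ : ℝ) (hM : 0 < M) (hU : (0 : E3) ∉ (exteriorRegion ρ₁ : Set E3)),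
      0 < ρ₁ ∧ ρ₁ < M / 40 ∧
      ∃ φ : exteriorRegion ρ₁ → E3,
        Topology.IsOpenEmbedding φ ∧ ContMDiff 𝓘(ℝ, E3) (𝓡 3) ((⊤ : ℕ∞) : WithTop ℕ∞) φ ∧
        IsCompact (Set.range φ)ᶜ ∧
        (∀ y : exteriorRegion ρ₁,
          pullbackBilin (I := 𝓡 3) (I' := 𝓘(ℝ, E3)) φ D.h.inner y =
            (Schwarzschild.conformalData (exteriorRegion ρ₁) hM.le hU).h.inner y) ∧
        ∀ y : exteriorRegion ρ₁, pullbackBilin (I := 𝓡 3) (I' := 𝓘(ℝ, E3)) φ D.k y = 0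

/-- **First lemma of the line (transfer): the bag of gold re-sliced in the explicit Kruskal
development witnesses the crux.** Pure Schwarzschild/Kruskal geometry, no PDE: the exact two-sheeted
region `E = {ρ₁ < ‖y‖}` of the bag has, inside Kruskal(`M`), a domain of dependence containing region I
and the part `{U < U_E}` of the black-hole region II (`U_E² = (ρ_E/2M − 1) e^{ρ_E/2M}`, `ρ_E > 10M` the
areal radius reached on sheet 2), hence containing the crux's bent slice `{t* = T_{M,0}(r), r > r₁}` for
every `r₁ ∈ (0, 2M)` (`U ≤ 1` there); a spherically symmetric spacelike bend through region III joins its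
inner sphere to the `{T = 0}` slice short of the gold; the induced data on the new hypersurface `≅ E3`
are smooth, vacuum, complete, one-ended with the Boyer–Lindquist (`t = const`, `k = 0`) end, i.e.
admissible, and equal the hard-coded Kerr(`M`, `a = 0`) slice data on `{r > r₁}`. -/
def Transfer : Prop :=
  SchwarzschildBagOfGoldExists →
    Summit.FinalStateConjecture.FinalStateConjecture.Theses.SwallowTheDatum.KerrShieldedDataExist

end Summit.FinalStateConjecture.FinalStateConjecture.Cruxes.KerrShieldedDataExist.BagOfGoldThroatRecession

end
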